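import Summits.Ventures.CertifiedManyBodySolver.Theorems.M3x2EdgeSplitSymReplayOutRouteHS
import HarnessLib

/-!
# SymReplay checker — chunked assembly of per-module fact families (`OutFactsP` / `OutFactsHS` / `OutFactsHSBZ`)

(team lb-sym, cell hub-lb; glue item (1) of hub-lb-sym-plan-1's grammar check of `…OutRouteHS` (STATUS 2026-08-28 l.1966);
hub-lb-sym-eng-4 g2.  ADDITIVE on `…OutRouteHS`; nothing landed is touched.)

WHY.  An E-class certificate closes through `energyDensity_ge_of_outroutePM … (hfacts : OutFactsP lo hi oP S 0 J)` with
`J ≈ 100–350` per-module facts; the anonymous-constructor assembly `⟨out_0, out_1, …, trivial⟩` is a `J`-deep nested term.  The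
append lemmas below let the Cert module assemble facts in flat chunks (e.g. one chunk per group of fact files) and concatenate:
`OutFactsP.append : OutFactsP … i m → OutFactsP … (i + m) n → OutFactsP … i (m + n)`; `ofFn`-style constructors from a
pointwise hypothesis are given too (`outFactsP_of_forall`).

HONEST FRAMING: assembly glue; no certificate lands by this file; no bound of record moves; no summit or crux statement is proved
here; nothing here predicts superconductivity.
-/

namespace Summit.Ventures.CertifiedManyBodySolver.Theorems.SymReplay

open Literature.Probability.LatticeModels

/-- Concatenate two consecutive chunks of packed facts. -/
theorem OutFactsP.append {lo hi : ℤ × ℤ} {oP : PackedNF.PWord → PackedNF.PHint} {S : ℕ → QPoly} :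
    ∀ {m i n : ℕ}, OutFactsP lo hi oP S i m → OutFactsP lo hi oP S (i + m) n → OutFactsP lo hi oP S i (m + n)
  | 0, i, n, _, h2 => by simpa [Nat.zero_add] using h2
  | m + 1, i, n, h1, h2 => by
    rw [Nat.add_right_comm]
    exact ⟨h1.1, OutFactsP.append h1.2 (by rw [Nat.add_assoc, Nat.add_comm 1 m]; exact h2)⟩

/-- Packed facts from a pointwise hypothesis on the window `[i, i+n)`. -/
theorem outFactsP_of_forall {lo hi : ℤ × ℤ} {oP : PackedNF.PWord → PackedNF.PHint} {S : ℕ → QPoly} :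
    ∀ (n i : ℕ), (∀ k, i ≤ k → k < i + n → PackedNF.ppipeOKHBZ lo hi oP (S k) = true) → OutFactsP lo hi oP S i n
  | 0, _, _ => trivial
  | n + 1, i, h => ⟨h i (le_refl _) (by omega), outFactsP_of_forall n (i + 1) fun k hk hk' => h k (by omega) (by omega)⟩

/-- Concatenate two consecutive chunks of frame-list hinted facts. -/
theorem OutFactsHS.append {K : SymCertR} {oracle : Word → HintT} {S : ℕ → QPoly} :
    ∀ {m i n : ℕ}, OutFactsHS K oracle S i m → OutFactsHS K oracle S (i + m) n → OutFactsHS K oracle S i (m + n)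
  | 0, i, n, _, h2 => by simpa [Nat.zero_add] using h2
  | m + 1, i, n, h1, h2 => by
    rw [Nat.add_right_comm]
    exact ⟨h1.1, OutFactsHS.append h1.2 (by rw [Nat.add_assoc, Nat.add_comm 1 m]; exact h2)⟩

/-- Concatenate two consecutive chunks of executed-box hinted facts. -/
theorem OutFactsHSBZ.append {K : SymCertR} {oracle : Word → HintT} {S : ℕ → QPoly} {lo hi : ℤ × ℤ} :
    ∀ {m i n : ℕ}, OutFactsHSBZ K oracle S lo hi i m → OutFactsHSBZ K oracle S lo hi (i + m) n →
      OutFactsHSBZ K oracle S lo hi i (m + n)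
  | 0, i, n, _, h2 => by simpa [Nat.zero_add] using h2
  | m + 1, i, n, h1, h2 => by
    rw [Nat.add_right_comm]
    exact ⟨h1.1, OutFactsHSBZ.append h1.2 (by rw [Nat.add_assoc, Nat.add_comm 1 m]; exact h2)⟩

/-- Executed-box hinted facts from a pointwise hypothesis on the window `[i, i+n)`. -/
theorem outFactsHSBZ_of_forall {K : SymCertR} {oracle : Word → HintT} {S : ℕ → QPoly} {lo hi : ℤ × ℤ} :
    ∀ (n i : ℕ), (∀ k, i ≤ k → k < i + n → isZero (canonNFZHBZ lo hi oracle (S k)) = true) →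
      OutFactsHSBZ K oracle S lo hi i n
  | 0, _, _ => trivial
  | n + 1, i, h => ⟨h i (le_refl _) (by omega), outFactsHSBZ_of_forall n (i + 1) fun k hk hk' => h k (by omega) (by omega)⟩

/-! ##### Demo of the chunked grammar (three chunks of sizes 2 + 1 + 2 from five named facts) -/

example {lo hi : ℤ × ℤ} {oP : PackedNF.PWord → PackedNF.PHint} {S : ℕ → QPoly}
    (f0 : PackedNF.ppipeOKHBZ lo hi oP (S 0) = true) (f1 : PackedNF.ppipeOKHBZ lo hi oP (S 1) = true)
    (f2 : PackedNF.ppipeOKHBZ lo hi oP (S 2) = true) (f3 : PackedNF.ppipeOKHBZ lo hi oP (S 3) = true)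
    (f4 : PackedNF.ppipeOKHBZ lo hi oP (S 4) = true) : OutFactsP lo hi oP S 0 5 :=
  have c0 : OutFactsP lo hi oP S 0 2 := ⟨f0, f1, trivial⟩
  have c1 : OutFactsP lo hi oP S 2 1 := ⟨f2, trivial⟩
  have c2 : OutFactsP lo hi oP S 3 2 := ⟨f3, f4, trivial⟩
  (c0.append c1).append c2

end Summit.Ventures.CertifiedManyBodySolver.Theorems.SymReplay
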